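import Summits.ABC.IUTFork.Joshi.ArchimedeanOstrowskiArtin
import Mathlib.Analysis.Normed.Algebra.GelfandMazur
import Mathlib.NumberTheory.Ostrowski
import Mathlib.NumberTheory.NumberField.Completion.InfinitePlace
import Mathlib.Analysis.Normed.Field.Ultra
import Mathlib.Analysis.Normed.Field.Instances
import Mathlib.FieldTheory.Finite.Basic

/-!
# Ostrowski's theorem on archimedean absolute values: `v = ‖ι(·)‖^s` for a field embedding `ι : K →+* ℂ`
# (proof-only; the generic engine behind [J-II½] Prop. 2.3.1 — Mathlib's Gelfand–Mazur over `ℝ` + its stated TODO)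

Proof-only companion file of the abc-iut cell, branch E «type Joshi's construction, test vs S» (rung LADDER-ABC:A2.E;
seat abc-iut-E-t38, gen 4; lineage slot T-38 = [J-II½] arXiv:2305.10398v12 §2–§3). Slot T-38's
`Joshi/ArchimedeanUntiltsJoshi.lean` (p432383) typed Joshi's «Proposition 2.3.1 (Ostrowski's Theorem). Any archimedean
valuation on ℂ (in the above sense) is of the form |−|^s_ℂ for 0 < s ∈ ℝ» (p.12 l.7–10) twice: LITERALLY
(`ATS2half.Prop231Literal`, refuted in kernel by E-t60's `Joshi.not_prop231Literal`, p433575: wild automorphisms of `ℂ`)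
and in the reading of the classical theorem it names (`ATS2half.Prop231`: `abs = |ι(·)|^s_ℂ` for a field embedding
`ι : ℂ →+* ℂ`), the latter left as a claim-tagged HYPOTHESIS («NONE in Mathlib for ℂ», INVENTORY-2). THIS FILE proves the
classical theorem in kernel, for ANY field:

* `exists_ringHom_complex_rpow_eq` (**Ostrowski 1916**): if `v : AbsoluteValue K ℝ` on a field `K` is not
  non-archimedean, there are a field embedding `ι : K →+* ℂ` and an exponent `0 < s ≤ 1` with `v x = ‖ι x‖ ^ s` for all `x`.

ROUTE (standard; Neukirch, *Algebraic Number Theory* II (4.2); Artin, *Algebraic numbers and algebraic functions* I §1–2):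
§1 (sibling file `Joshi/ArchimedeanOstrowskiArtin.lean`) Artin's lemma in a two-parameter form — a multiplicative
non-negative `f` with a polynomial bound `f (∑_{i<N} x_i) ≤ C·N^p·max f(x_i)` and a linear bound `f(m) ≤ D·m` on naturals
satisfies the triangle inequality (`n`-th power trick); in particular the renormalisation lemma `rpow_add_le_add`.
§2 not non-archimedean ⟹ characteristic `0` and `v` unbounded on `ℕ` ⟹ (Mathlib's Ostrowski theorem on `ℚ`,
`Rat.AbsoluteValue.equiv_real_of_unbounded`) some power `w = v^c` agrees with `|·|` on `ℚ`; `w` is again an absolute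
value by §1. §3 the completion of `(K, w)` receives an isometric ring map from `ℝ` (Mathlib's completion of `ℚ` at its
infinite place ≅ `ℝ`, `Isometry.extensionHom`), hence is a normed `ℝ`-algebra; Mathlib's **Gelfand–Mazur theorem over
`ℝ`** (`NormedAlgebra.Real.nonempty_algEquiv_or`, M. Stoll 2025 — whose docstring names exactly this corollary as
TODO) makes it `ℝ` or `ℂ` as an `ℝ`-algebra, and the norm is forced to be the standard one (multiplicativity). §4 assembles.

FRAMING. Standard mathematics, no Joshi-specific content; the Joshi-side discharge `prop231_holds : ATS2half.Prop231` is
the sibling file `Joshi/ArchimedeanOstrowskiProp231Holds.lean`. No side is taken on [IUTchIII] Cor. 3.12 or on any author;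
typed ≠ proved; no `def`, no hypothesis `Prop`, nothing of the cell's frozen interface imported. Standard axioms only;
sorry-free. bears_on: LADDER-ABC:A2.E
-/

set_option autoImplicit false

noncomputable section

open Filter Topology Finset

namespace Summit.ABC.IUTFork.Joshi.ArchimedeanOstrowski


/-! ## 2. Not non-archimedean ⟹ characteristic `0`, unbounded on `ℕ`, and a power agreeing with `|·|` on `ℚ` -/

section Renormalise

variable {K : Type*} [Field K]

/-- If `v n ≤ 1` for every natural `n`, then `v` is non-archimedean (Mathlib's
`IsUltrametricDist.isUltrametricDist_of_forall_norm_natCast_le_one`, transported through `WithAbs v`). [folklore] -/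
theorem isNonarchimedean_of_forall_natCast_le_one (v : AbsoluteValue K ℝ) (h : ∀ n : ℕ, v n ≤ 1) :
    IsNonarchimedean v := by
  have hU : IsUltrametricDist (WithAbs v) :=
    IsUltrametricDist.isUltrametricDist_of_forall_norm_natCast_le_one fun n => by
      rw [WithAbs.norm_eq_apply_ofAbs]
      have hn : WithAbs.ofAbs (n : WithAbs v) = (n : K) := map_natCast (WithAbs.equiv v) n
      rw [hn]
      exact h n
  have hN := @IsUltrametricDist.isNonarchimedean_norm (WithAbs v) _ hU
  intro a b
  have hab : ‖WithAbs.toAbs v a + WithAbs.toAbs v b‖ ≤ max ‖WithAbs.toAbs v a‖ ‖WithAbs.toAbs v b‖ :=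
    hN (WithAbs.toAbs v a) (WithAbs.toAbs v b)
  rwa [← WithAbs.toAbs_add, WithAbs.norm_toAbs_eq, WithAbs.norm_toAbs_eq, WithAbs.norm_toAbs_eq] at hab

/-- A not non-archimedean absolute value exceeds `1` at some natural number. [folklore] -/
theorem exists_one_lt_natCast (v : AbsoluteValue K ℝ) (hv : ¬ IsNonarchimedean v) : ∃ n : ℕ, 1 < v n := by
  by_contra h
  exact hv (isNonarchimedean_of_forall_natCast_le_one v fun n => le_of_not_gt fun hn => h ⟨n, hn⟩)

/-- … hence the field has characteristic zero: in characteristic `p` every `(n : K)` lies in the prime field,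
where Fermat's little theorem `a^(p-1) = 1` forces `v n ≤ 1`. [folklore] -/
theorem charZero_of_not_isNonarchimedean (v : AbsoluteValue K ℝ) (hv : ¬ IsNonarchimedean v) : CharZero K := by
  obtain ⟨n, hn⟩ := exists_one_lt_natCast v hv
  obtain ⟨p, hp⟩ := CharP.exists K
  rcases CharP.char_is_prime_or_zero K p with hprime | rfl
  · exfalso
    haveI := Fact.mk hprime
    have hcast : (n : K) = ZMod.castHom (dvd_refl p) K (n : ZMod p) :=
      (map_natCast (ZMod.castHom (dvd_refl p) K) n).symm
    have hle : v n ≤ 1 := by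
      by_cases h0 : (n : ZMod p) = 0
      · rw [hcast, h0, map_zero, map_zero]
        exact zero_le_one
      · have hpow : (n : K) ^ (p - 1) = 1 := by
          rw [hcast, ← map_pow, ZMod.pow_card_sub_one_eq_one h0, map_one]
        have h1 : v n ^ (p - 1) = 1 := by rw [← map_pow, hpow, map_one]
        have hp1 : p - 1 ≠ 0 := by have := hprime.two_le; omega
        exact ((pow_eq_one_iff_of_nonneg (v.nonneg _) hp1).mp h1).le
    exact absurd hle (not_le.mpr hn)
  · exact CharP.charP_to_charZero K

/-- Mathlib's Ostrowski theorem on `ℚ` (`Rat.AbsoluteValue.equiv_real_of_unbounded`) supplies the exponent: some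
positive power of `v` is the identity on `ℕ`. [folklore] -/
theorem exists_rpow_natCast_eq (v : AbsoluteValue K ℝ) (hv : ¬ IsNonarchimedean v) :
    ∃ c : ℝ, 0 < c ∧ ∀ n : ℕ, v n ^ c = n := by
  haveI := charZero_of_not_isNonarchimedean v hv
  obtain ⟨n, hn⟩ := exists_one_lt_natCast v hv
  let f : AbsoluteValue ℚ ℝ := v.comp (Rat.castHom K).injective
  have hf : ∀ m : ℕ, f m = v m := fun m => by
    show v (Rat.castHom K (m : ℚ)) = v m
    rw [map_natCast]
  have notbdd : ¬ ∀ m : ℕ, f m ≤ 1 := fun hall => absurd (hall n) (by rw [hf]; exact not_le.mpr hn)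
  obtain ⟨c, hc, h⟩ := Rat.AbsoluteValue.exists_nat_rpow_iff_isEquiv.mpr
    (Rat.AbsoluteValue.equiv_real_of_unbounded notbdd)
  refine ⟨c, hc, fun m => ?_⟩
  rw [← hf, h m, Rat.AbsoluteValue.real_eq_abs]
  simp

/-- **The renormalised absolute value.** With `c` as above, `w := v^c` is again an absolute value (§1,
`rpow_add_le_add`), `1 ≤ c`, and `w` is the ordinary absolute value on `ℚ ⊆ K`. [folklore] -/
theorem exists_absoluteValue_rpow_eq_ratCast [CharZero K] (v : AbsoluteValue K ℝ)
    (hv : ¬ IsNonarchimedean v) :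
    ∃ (c : ℝ) (w : AbsoluteValue K ℝ), 1 ≤ c ∧ (∀ x, w x = v x ^ c) ∧
      ∀ q : ℚ, w (q : K) = |(q : ℝ)| := by
  obtain ⟨c, hc, hnat⟩ := exists_rpow_natCast_eq v hv
  let w : AbsoluteValue K ℝ :=
    { toFun := fun x => v x ^ c
      map_mul' := fun a b => by
        show v (a * b) ^ c = v a ^ c * v b ^ c
        rw [map_mul, Real.mul_rpow (v.nonneg a) (v.nonneg b)]
      nonneg' := fun x => Real.rpow_nonneg (v.nonneg x) c
      eq_zero' := fun x => by
        show v x ^ c = 0 ↔ x = 0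
        rw [Real.rpow_eq_zero_iff_of_nonneg (v.nonneg x), v.eq_zero]
        simp [hc.ne']
      add_le' := fun a b => rpow_add_le_add v hc hnat a b }
  have hw : ∀ x, w x = v x ^ c := fun _ => rfl
  refine ⟨c, w, ?_, hw, ?_⟩
  · have h2 : v 2 ≤ 2 :=
      calc v 2 = v (1 + 1) := by norm_num
        _ ≤ v 1 + v 1 := v.add_le 1 1
        _ = 2 := by rw [map_one]; norm_num
    have h2c : v 2 ^ c = 2 := by simpa using hnat 2
    have h22 : (2 : ℝ) ≤ 2 ^ c :=
      calc (2 : ℝ) = v 2 ^ c := h2c.symm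
        _ ≤ 2 ^ c := Real.rpow_le_rpow (v.nonneg _) h2 hc.le
    exact (Real.rpow_le_rpow_left_iff one_lt_two).mp (by rw [Real.rpow_one]; exact h22)
  · intro q
    have heq : w.comp (Rat.castHom K).injective = Rat.AbsoluteValue.real := by
      rw [← Rat.AbsoluteValue.eq_on_nat_iff_eq]
      intro m
      show w (Rat.castHom K (m : ℚ)) = _
      rw [map_natCast, hw, hnat, Rat.AbsoluteValue.real_eq_abs]
      simp
    have hq : w (q : K) = Rat.AbsoluteValue.real q := congrArg (fun g : AbsoluteValue ℚ ℝ => g q) heq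
    rw [hq, Rat.AbsoluteValue.real_eq_abs, Rat.cast_abs]

end Renormalise

/-! ## 3. The completion is a normed `ℝ`-algebra; Gelfand–Mazur over `ℝ`; the norm is the standard one -/

section GelfandMazur

/-- If an absolute value `w` on a characteristic-zero field `K` is the ordinary one on `ℚ`, the completion of
`(K, w)` receives a NORM-PRESERVING ring map from `ℝ`: the completion of `ℚ` at its infinite place is `ℝ`
(Mathlib: `NumberField.InfinitePlace.Completion.ringEquivRealOfIsReal`, an isometry), and the isometric map
`ℚ → K → K̂` extends to it (`Isometry.extensionHom`). [folklore] -/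
theorem exists_real_ringHom_norm_eq {K : Type*} [Field K] [CharZero K] (w : AbsoluteValue K ℝ)
    (hw : ∀ q : ℚ, w (q : K) = |(q : ℝ)|) :
    ∃ ψ : ℝ →+* w.Completion, ∀ r, ‖ψ r‖ = |r| := by
  let j : WithAbs Rat.infinitePlace.1 →+* w.Completion :=
    (UniformSpace.Completion.coeRingHom : WithAbs w →+* w.Completion).comp
      ((WithAbs.equiv w).symm.toRingHom.comp
        ((Rat.castHom K).comp (WithAbs.equiv Rat.infinitePlace.1).toRingHom))
  have hj : ∀ x, ‖j x‖ = ‖x‖ := by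
    intro x
    show ‖((WithAbs.toAbs w ((WithAbs.ofAbs x : ℚ) : K) : WithAbs w) : w.Completion)‖ = ‖x‖
    rw [UniformSpace.Completion.norm_coe, WithAbs.norm_toAbs_eq, hw, WithAbs.norm_eq_apply_ofAbs,
      ← NumberField.InfinitePlace.coe_apply, Rat.infinitePlace_apply, Rat.cast_abs]
  have hiso : Isometry j := AddMonoidHomClass.isometry_of_norm j hj
  have hR := Rat.isReal_infinitePlace
  have he : ∀ y, ‖NumberField.InfinitePlace.Completion.ringEquivRealOfIsReal hR y‖ = ‖y‖ :=
    (AddMonoidHomClass.isometry_iff_norm _).mp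
      (NumberField.InfinitePlace.Completion.isometry_extensionEmbeddingOfIsReal hR)
  have h1 : ∀ t, ‖hiso.extensionHom t‖ = ‖t‖ :=
    (AddMonoidHomClass.isometry_iff_norm _).mp hiso.completion_extension
  refine ⟨hiso.extensionHom.comp
    ((NumberField.InfinitePlace.Completion.equiv Rat.infinitePlace).toRingHom.comp
      (NumberField.InfinitePlace.Completion.ringEquivRealOfIsReal hR).symm.toRingHom), fun r => ?_⟩
  have h2 : ‖(NumberField.InfinitePlace.Completion.ringEquivRealOfIsReal hR).symm r‖ = ‖r‖ := by
    rw [← he ((NumberField.InfinitePlace.Completion.ringEquivRealOfIsReal hR).symm r),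
      RingEquiv.apply_symm_apply]
  simp only [RingHom.comp_apply, RingEquiv.toRingHom_eq_coe, RingEquiv.coe_toRingHom]
  rw [h1, NumberField.InfinitePlace.Completion.equiv_apply,
    NumberField.InfinitePlace.Completion.norm_toCompletion, h2, Real.norm_eq_abs]

open ComplexConjugate in
/-- **Gelfand–Mazur step.** A normed field `L` receiving a norm-preserving ring map `ψ : ℝ →+* L` is a normed
`ℝ`-algebra, hence (`NormedAlgebra.Real.nonempty_algEquiv_or`) `ℝ`-isomorphic to `ℝ` or to `ℂ`; in either case the
isomorphism matches norms (multiplicativity of both norms: `‖e⁻¹ c‖ ≤ 2‖c‖` bootstraps to `≤ ‖c‖` via powers, and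
`c·c̄ ∈ ℝ` gives `≥`). So `L` embeds into `ℂ` norm-preservingly. [folklore] -/
theorem exists_ringHom_complex_norm_eq {L : Type*} [NormedField L] (ψ : ℝ →+* L)
    (hψ : ∀ r, ‖ψ r‖ = |r|) : ∃ θ : L →+* ℂ, ∀ z, ‖θ z‖ = ‖z‖ := by
  letI : Algebra ℝ L := ψ.toAlgebra
  have hψ' : ∀ r : ℝ, algebraMap ℝ L r = ψ r := fun _ => rfl
  letI : NormedAlgebra ℝ L :=
    ⟨fun r z => by rw [Algebra.smul_def, hψ', norm_mul, hψ, Real.norm_eq_abs]⟩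
  rcases NormedAlgebra.Real.nonempty_algEquiv_or L with ⟨⟨e⟩⟩ | ⟨⟨e⟩⟩
  · -- `L ≃ₐ[ℝ] ℝ`: every `z` is `ψ (e z)`
    refine ⟨(algebraMap ℝ ℂ).comp (e : L →+* ℝ), fun z => ?_⟩
    have hz : ψ (e z) = z := by
      rw [← hψ', ← e.symm.commutes (e z), Algebra.algebraMap_self_apply, e.symm_apply_apply]
    rw [RingHom.comp_apply, RingHom.coe_coe, Complex.coe_algebraMap, Complex.norm_real, Real.norm_eq_abs,
      ← hψ (e z), hz]
  · -- `L ≃ₐ[ℝ] ℂ`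
    have hreal : ∀ r : ℝ, e.symm (r : ℂ) = ψ r := fun r => by
      rw [← Complex.coe_algebraMap, e.symm.commutes r, hψ']
    have hmul : ∀ c d : ℂ, ‖e.symm (c * d)‖ = ‖e.symm c‖ * ‖e.symm d‖ := fun c d => by
      rw [map_mul, norm_mul]
    have hI : ‖e.symm Complex.I‖ = 1 := by
      have hsq : ‖e.symm Complex.I‖ ^ 2 = 1 := by
        rw [← norm_pow, ← map_pow, Complex.I_sq, map_neg, map_one, norm_neg, norm_one]
      exact (pow_eq_one_iff_of_nonneg (norm_nonneg _) two_ne_zero).mp hsq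
    have hle2 : ∀ c : ℂ, ‖e.symm c‖ ≤ 2 * ‖c‖ := fun c => by
      have hc : e.symm c = ψ c.re + ψ c.im * e.symm Complex.I := by
        conv_lhs => rw [← Complex.re_add_im c]
        rw [map_add, map_mul, hreal, hreal]
      rw [hc]
      calc ‖ψ c.re + ψ c.im * e.symm Complex.I‖ ≤ ‖ψ c.re‖ + ‖ψ c.im * e.symm Complex.I‖ := norm_add_le _ _
        _ = |c.re| + |c.im| := by rw [norm_mul, hI, mul_one, hψ, hψ]
        _ ≤ ‖c‖ + ‖c‖ := add_le_add (Complex.abs_re_le_norm c) (Complex.abs_im_le_norm c)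
        _ = 2 * ‖c‖ := by ring
    have hle : ∀ c : ℂ, ‖e.symm c‖ ≤ ‖c‖ := fun c => by
      refine le_of_not_gt fun hlt => ?_
      rcases eq_or_ne c 0 with rfl | hc0
      · simp at hlt
      have hcpos : 0 < ‖c‖ := norm_pos_iff.mpr hc0
      have hρ : 1 < ‖e.symm c‖ / ‖c‖ := (one_lt_div hcpos).mpr hlt
      obtain ⟨n, hn⟩ := ((tendsto_pow_atTop_atTop_of_one_lt hρ).eventually_gt_atTop 2).exists
      have hbd : (‖e.symm c‖ / ‖c‖) ^ n ≤ 2 := by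
        rw [div_pow, div_le_iff₀ (pow_pos hcpos n), ← norm_pow, ← norm_pow, ← map_pow]
        exact hle2 (c ^ n)
      exact absurd hbd (not_le.mpr hn)
    have hge : ∀ c : ℂ, ‖c‖ ≤ ‖e.symm c‖ := fun c => by
      rcases eq_or_ne c 0 with rfl | hc0
      · simp
      have hcpos : 0 < ‖c‖ := norm_pos_iff.mpr hc0
      have hsq : ‖c‖ * ‖c‖ = ‖e.symm c‖ * ‖e.symm (conj c)‖ := by
        rw [← hmul, Complex.mul_conj, Complex.normSq_eq_norm_sq, Complex.ofReal_pow, ← Complex.ofReal_pow,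
          hreal, hψ, abs_of_nonneg (sq_nonneg _), sq]
      have h3 : ‖c‖ * ‖c‖ ≤ ‖e.symm c‖ * ‖c‖ :=
        calc ‖c‖ * ‖c‖ = ‖e.symm c‖ * ‖e.symm (conj c)‖ := hsq
          _ ≤ ‖e.symm c‖ * ‖conj c‖ := mul_le_mul_of_nonneg_left (hle _) (norm_nonneg _)
          _ = ‖e.symm c‖ * ‖c‖ := by rw [Complex.norm_conj]
      exact le_of_mul_le_mul_right h3 hcpos
    refine ⟨(e : L →+* ℂ), fun z => ?_⟩
    rw [RingHom.coe_coe]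
    have h := le_antisymm (hle (e z)) (hge (e z))
    rw [e.symm_apply_apply] at h
    exact h.symm

end GelfandMazur

/-! ## 4. Ostrowski's theorem for archimedean absolute values -/

/-- **Ostrowski's theorem (archimedean absolute values).** An absolute value `v : K → ℝ` on a field `K` which is
not non-archimedean is `‖ι(·)‖^s` for a field embedding `ι : K →+* ℂ` and an exponent `0 < s ≤ 1`.
(Ostrowski 1916; Neukirch, *Algebraic Number Theory* II (4.2); Artin, *Algebraic numbers and algebraic functions*
I §2; the TODO of Mathlib's `Analysis/Normed/Algebra/GelfandMazur.lean`.) [folklore] -/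
theorem exists_ringHom_complex_rpow_eq {K : Type*} [Field K] (v : AbsoluteValue K ℝ)
    (hv : ¬ IsNonarchimedean v) :
    ∃ (ι : K →+* ℂ) (s : ℝ), 0 < s ∧ s ≤ 1 ∧ ∀ x, v x = ‖ι x‖ ^ s := by
  haveI := charZero_of_not_isNonarchimedean v hv
  obtain ⟨c, w, hc1, hwv, hwq⟩ := exists_absoluteValue_rpow_eq_ratCast v hv
  have hc : 0 < c := lt_of_lt_of_le one_pos hc1
  obtain ⟨ψ, hψ⟩ := exists_real_ringHom_norm_eq w hwq
  obtain ⟨θ, hθ⟩ := exists_ringHom_complex_norm_eq ψ hψ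
  let ι : K →+* ℂ := θ.comp ((UniformSpace.Completion.coeRingHom : WithAbs w →+* w.Completion).comp
    (WithAbs.equiv w).symm.toRingHom)
  refine ⟨ι, c⁻¹, inv_pos.mpr hc, inv_le_one_of_one_le₀ hc1, fun x => ?_⟩
  have h1 : ‖ι x‖ = w x := by
    show ‖θ ((WithAbs.toAbs w x : WithAbs w) : w.Completion)‖ = w x
    rw [hθ, UniformSpace.Completion.norm_coe, WithAbs.norm_toAbs_eq]
  rw [h1, hwv, Real.rpow_rpow_inv (v.nonneg x) hc.ne']

/-- The converse direction (elementary): `‖ι(·)‖^s` IS an absolute value on `K` that is not non-archimedean, for every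
field embedding `ι : K →+* ℂ` and `0 < s ≤ 1` — so Ostrowski's theorem is a characterisation. [folklore] -/
theorem not_isNonarchimedean_norm_comp_rpow {K : Type*} [Field K] (ι : K →+* ℂ) {s : ℝ} (hs : 0 < s) :
    ¬ IsNonarchimedean (fun x : K => ‖ι x‖ ^ s) := by
  intro h
  have h2 := h 1 1
  simp only [map_one, norm_one, Real.one_rpow] at h2
  have h12 : (1 : K) + 1 = 2 := by norm_num
  rw [h12, map_ofNat, Complex.norm_ofNat, max_self] at h2
  exact absurd h2 (not_le.mpr (Real.one_lt_rpow one_lt_two hs))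

/-- **Corollary (infinite places).** A not non-archimedean absolute value `v` on a field `K` is a power `w^s`
(`0 < s ≤ 1`) of an infinite place `w` of `K` in Mathlib's sense (`NumberField.InfinitePlace K` = the absolute values
`‖φ(·)‖`, `φ : K →+* ℂ`), and in particular is equivalent to it; for a number field this is the archimedean half of
«Ostrowski's theorem for number fields» (Neukirch, *Algebraic Number Theory* II (8.1)). [folklore] -/
theorem exists_infinitePlace_rpow_eq {K : Type*} [Field K] (v : AbsoluteValue K ℝ)
    (hv : ¬ IsNonarchimedean v) :
    ∃ (w : NumberField.InfinitePlace K) (s : ℝ), 0 < s ∧ s ≤ 1 ∧ (∀ x, v x = w x ^ s) ∧ v.IsEquiv w.1 := by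
  obtain ⟨ι, s, hs, hs1, h⟩ := exists_ringHom_complex_rpow_eq v hv
  have hw : ∀ x, v x = NumberField.InfinitePlace.mk ι x ^ s := fun x => by
    rw [NumberField.InfinitePlace.apply, h x]
  refine ⟨NumberField.InfinitePlace.mk ι, s, hs, hs1, hw, ?_⟩
  exact (AbsoluteValue.isEquiv_iff_exists_rpow_eq.mpr ⟨s, hs, funext fun x => (hw x).symm⟩).symm

end Summit.ABC.IUTFork.Joshi.ArchimedeanOstrowski
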